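import Summits.MatrixMultiplication.MatrixMultiplication.Theorems.SoloInformedCwTwoConjectureB1

/-!
# CONJECTURE B1 is false as stated; the ordered form B1′ (solo-informed, gen 13; CLAIMS c168)

`ConjectureB1` (both mixed orientations work on the dominant rigid type) is FALSE: the mixed design
`(2,29 | 18,31 ; 98,22)` satisfies both obligation relations (`2 + 29 = 31 = d₁`, `2 + (18 + 31) = 29 + 22`) but its
working set is `{TT, TU, UU}` — the orientation `![true, false]` (pair `0` oriented `U`, pair `1` oriented `T`) admits
no injective selection (found by exhaustive matching, three such designs among 109,734 planted ones; likewise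
`(4,60 | 19,55 ; 143,9,18)` and `(16,73 | 38,89 ; 70,195,11)`).  A kernel refutation needs a Hall-violator
certificate and is left to the next generation.  What survives all data (109,734 planted designs + the hard bed)
is the ORDERED form: orient the pair with the `(0,-1)` obligation `T` and the pair with the `(1,-1)` obligation `U`.

Standard axioms only.
-/

namespace Summit.MatrixMultiplication.MatrixMultiplication.Theorems

open Finset

/-- CONJECTURE B1′ (c168): on the dominant rigid type the orientation (pair `0` ↦ `T`, pair `1` ↦ `U`) works, where
pair `0` carries the `(0,-1)` obligation `s₀ + d₀ [+t] = d₁ [+t]` and pair `1` the `(1,-1)` obligation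
`s₀ + (s₁ + d₁) [+t] = d₀ [+t]`. -/
def ConjectureB1' : Prop :=
  ∀ {q : ℕ} (s d : Fin 2 → ℕ) (t : Fin q → ℕ), IsMixedDesign s d t →
    ∀ A B A' B' : Finset (Fin q), A.card + B.card ≤ 1 → A'.card + B'.card ≤ 1 →
      s 0 + (s 1 + d 1) + subsetSum t B = d 0 + subsetSum t A →
      s 0 + d 0 + subsetSum t B' = d 1 + subsetSum t A' →
      OrientedHallSix s d t ![false, true]

/-- The refuted conjunction implies the ordered form (bookkeeping). -/
theorem conjectureB1'_of_conjectureB1 (h : ConjectureB1) : ConjectureB1' :=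
  fun s d t hD A B A' B' hc hc' h₁ h₀ => (h s d t hD A B A' B' hc hc' h₁ h₀).1

/-- The counterexample to `ConjectureB1` does satisfy its two obligation hypotheses (with `A = {1}`, all other
sets empty), so only the orientation claim fails. -/
example : (![2, 18] : Fin 2 → ℕ) 0 + ((![2, 18] : Fin 2 → ℕ) 1 + (![29, 31] : Fin 2 → ℕ) 1) +
      subsetSum ![98, 22] ∅ = (![29, 31] : Fin 2 → ℕ) 0 + subsetSum ![98, 22] {1} ∧
    (![2, 18] : Fin 2 → ℕ) 0 + (![29, 31] : Fin 2 → ℕ) 0 + subsetSum ![98, 22] ∅ =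
      (![29, 31] : Fin 2 → ℕ) 1 + subsetSum ![98, 22] ∅ := by
  decide

end Summit.MatrixMultiplication.MatrixMultiplication.Theorems
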